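import Literature.NumberTheory.Automorphic.UnipotentRadicalCompactOpenProofs
import Literature.NumberTheory.Automorphic.UnitaryGroupBorelInduction
import Literature.NumberTheory.Automorphic.UnitaryGroupOfFormAdelicTopology
import HarnessLib

/-!
# The unipotent subgroup `N ≤ U(J)(F_v)` of a local unitary group is a limit of compact open subgroups;
# the Jacquet functor along the Borel of `U(Φ_N)(L⁺_v)` is exact

Topic `NumberTheory/Automorphic`; namespace `Literature.NumberTheory.Automorphic`.  Proof file (theorems only: no definition,
no named fact, no instance, no notation).

The tree's exactness of the Jacquet functor (★ `Representation.jacquetMap_injective`, [BernsteinZelevinsky1977, Prop. 1.9 (a)];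
file `JacquetModuleExactProofs`) takes the hypothesis `IsLimitOfCompactOpen t.N`: every compact subset of the «unipotent
radical» lies in a compact open subgroup.  The tree proves it for the upper unitriangular group of `GL_n` over a
non-archimedean local FIELD (★ `isLimitOfCompactOpen_upperUnitriangular`) and its block radicals (★
`isLimitOfCompactOpen_unipotentRadicalGL`), but not for the unipotent subgroup `N = unipotentU` of a local unitary group
`U(J)(F_v) ≤ GL_N(E ⊗_F F_v)`, `E ⊗_F F_v = Π_{w ∣ v} E_w` (★ `UnitaryGroup.LocalRing`) — the `N` of the Borel triple ★
`cmBorelTriple L N v` of `U(Φ_N)(L⁺_v)` along which ★ `cmPrincipalSeries` is induced.  This file supplies it: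

* §1 two transfer lemmas for ★ `IsLimitOfCompactOpen`: along a closed embedding of topological groups
  (`IsLimitOfCompactOpen.of_isClosedEmbedding`) and to finite products (`IsLimitOfCompactOpen.pi`);
* §2 `UnitaryGroup.isLimitOfCompactOpen_unipotentU_local`: for ANY form `J'` over `E ⊗_F F_v`, the upper unitriangular
  subgroup of `U(c ⊗ 1, J')(F_v)` is a limit of compact open subgroups — it embeds closedly into
  `Π_{w ∣ v} U_N(E_w)` along ★ `localGLPiEquiv`, each factor being ★ a limit of compact opens;
* §3 the CM instances: `UnitaryGroup.isLimitOfCompactOpen_cmBorelTriple_N` (`(cmBorelTriple L N v).N`, every `N`, every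
  finite place `v` of `L⁺`), and the resulting LEFT EXACTNESS `UnitaryGroup.jacquetMap_cmBorel_injective` of the Jacquet functor
  along the Borel of `U(Φ_N)(L⁺_v)` on smooth representations (★ `jacquetMap_injective` with its hypothesis discharged).

Consumers: every Jordan–Hölder ∕ length argument on the principal series of `U(Φ₃)(L⁺_v)` ([Casselman1995, §7.1];
[Rogawski1990, §12.2]) — the in-house roads to the named facts `U3PrincipalSeriesLengthLeTwo`,
`Rogawski1990.cmPrincipalSeries_isConstituentOf_weylConj`, `U3PrincipalSeriesConstituentEmbeds`.

## References
* [BernsteinZelevinsky1977] I. N. Bernstein, A. V. Zelevinsky, *Induced representations of reductive `p`-adic groups I*,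
  Ann. Sci. ÉNS 10 (1977), §1.9 and Prop. 1.9 (a) («`U` is the union of its compact open subgroups»).
* [Casselman1995] W. Casselman, *Introduction to the theory of admissible representations of `p`-adic reductive groups*
  (1995 notes), Prop. 3.2.3 (exactness), §7.1.
* [PlatonovRapinchuk1994] V. Platonov, A. Rapinchuk, *Algebraic Groups and Number Theory* (1994), §3.3, §5.1
  (`G_{F_v} ≤ GL_N(E ⊗ F_v) = Π_{w∣v} GL_N(E_w)`).
-/

set_option autoImplicit false

noncomputable section

open NumberField IsDedekindDomain
open _root_.Topology

namespace Literature.NumberTheory.Automorphic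

/-! ## §1 Transfer of `IsLimitOfCompactOpen` -/

section Transfer

variable {H H' : Type*} [Group H] [TopologicalSpace H] [Group H'] [TopologicalSpace H']

/-- **A closed subgroup of a limit of compact open subgroups is one**, in embedded form: if `φ : H →* H'` is a closed
topological embedding and every compact subset of `H'` lies in a compact open subgroup, then so does every compact subset
of `H` (`C ⊆ φ⁻¹(K)` for a compact open `K ⊇ φ(C)`; the preimage is compact because `φ` is a closed embedding).
[cite: BernsteinZelevinsky1977, §1.9] -/
theorem IsLimitOfCompactOpen.of_isClosedEmbedding (φ : H →* H') (hφ : IsClosedEmbedding φ)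
    (h' : IsLimitOfCompactOpen H') : IsLimitOfCompactOpen H := by
  intro C hC
  obtain ⟨K, hKo, hKc, hCK⟩ := h' (φ '' C) (hC.image hφ.continuous)
  exact ⟨K.comap φ, hKo.preimage hφ.continuous, hφ.isCompact_preimage hKc, fun x hx => hCK ⟨x, hx, rfl⟩⟩

/-- **A finite product of limits of compact open subgroups is one**: a compact `C ⊆ Π_i H_i` projects to compacts
`C_i ⊆ K_i` (compact open subgroups), and `Π_i K_i` is a compact open subgroup containing `C`. [cite: BernsteinZelevinsky1977, §1.9] -/
theorem IsLimitOfCompactOpen.pi {ι : Type*} [Finite ι] {G : ι → Type*} [∀ i, Group (G i)]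
    [∀ i, TopologicalSpace (G i)] (h : ∀ i, IsLimitOfCompactOpen (G i)) :
    IsLimitOfCompactOpen (∀ i, G i) := by
  intro C hC
  have hi := fun i => h i ((fun f : (∀ i, G i) => f i) '' C) (hC.image (continuous_apply i))
  choose K hKo hKc hCK using hi
  have hcoe : (Subgroup.pi Set.univ K : Set (∀ i, G i)) = Set.pi Set.univ fun i => (K i : Set (G i)) :=
    Subgroup.coe_pi Set.univ K
  refine ⟨Subgroup.pi Set.univ K, ?_, ?_, fun f hf i _ => hCK i ⟨f, hf, rfl⟩⟩
  · rw [hcoe]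
    exact isOpen_set_pi Set.finite_univ fun i _ => hKo i
  · rw [hcoe]
    exact isCompact_univ_pi fun i => hKc i

end Transfer

/-! ## §2 The upper unitriangular subgroup of a local unitary group `U(J')(F_v) ≤ GL_N(Π_{w ∣ v} E_w)` -/

namespace UnitaryGroup

section Local

variable {F : Type} [Field F] [NumberField F] (E : Type) [Field E] [NumberField E] [Algebra F E]
  (c : E ≃ₐ[F] E) (N : ℕ) (v : HeightOneSpectrum (𝓞 F)) (J' : Matrix (Fin N) (Fin N) (LocalRing E v))

/-- The `w`-component of an upper unitriangular element of `U(c ⊗ 1, J')(F_v) ≤ GL_N(Π_{w∣v} E_w)` is upper unitriangular in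
`GL_N(E_w)` (entries are evaluated componentwise, ★ `GLn.coe_piEquiv_apply`; private plumbing). [folklore] -/
private theorem localGLPiEquiv_mem_upperUnitriangular (x : ↥(unipotentU (conjLocal E c v) J')) (w : PlacesOver E v) :
    localGLPiEquiv E N v ((x : ↥(unitaryGroupOfForm (conjLocal E c v) J')) : GL (Fin N) (LocalRing E v)) w ∈
      upperUnitriangular (Fin N) (w.1.adicCompletion E) := by
  obtain ⟨htri, hdiag⟩ := (mem_unipotentU_iff _).1 x.2
  rw [mem_upperUnitriangular_iff]
  refine ⟨fun i j hij => ?_, fun i => ?_⟩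
  · rw [GLn.coe_piEquiv_apply, Matrix.map_apply, htri hij, map_zero]
  · rw [GLn.coe_piEquiv_apply, Matrix.map_apply, hdiag i, map_one]

/-- **The upper unitriangular subgroup `N ≤ U(c ⊗ 1, J')(F_v)` is a limit of compact open subgroups** (every compact subset lies
in a compact open subgroup), for every finite place `v` of `F` and every form `J'` over `E ⊗_F F_v = Π_{w∣v} E_w`: the componentwise
map `x ↦ (x_w)_w` is a CLOSED EMBEDDING `N ↪ Π_{w∣v} U_N(E_w)` — composed with the closed embedding `Π_w U_N(E_w) ↪ Π_w GL_N(E_w)`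
(★ `isClosed_upperUnitriangular`) it is `N ↪ U(J')(F_v) ↪ GL_N(Π_w E_w) ≃ₜ Π_w GL_N(E_w)` (★ `isClosed_unitaryGroupOfForm`, ★
`localGLPiEquiv`) — and each `U_N(E_w)` is such a limit (★ `isLimitOfCompactOpen_upperUnitriangular`); conclude by §1.
[cite: BernsteinZelevinsky1977, §1.9] -/
theorem isLimitOfCompactOpen_unipotentU_local : IsLimitOfCompactOpen ↥(unipotentU (conjLocal E c v) J') := by
  -- the componentwise homomorphism `N → Π_w U_N(E_w)` (★ `localGLPiEquiv` restricted and corestricted)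
  let ψ : ↥(unipotentU (conjLocal E c v) J') →*
      (∀ w : PlacesOver E v, ↥(upperUnitriangular (Fin N) (w.1.adicCompletion E))) :=
    { toFun := fun x w =>
        ⟨localGLPiEquiv E N v ((x : ↥(unitaryGroupOfForm (conjLocal E c v) J')) : GL (Fin N) (LocalRing E v)) w,
          localGLPiEquiv_mem_upperUnitriangular E c N v J' x w⟩
      map_one' := by
        funext w
        exact Subtype.ext (by simp)
      map_mul' := fun x y => by
        funext w
        exact Subtype.ext (by simp) }
  -- it is a closed embedding
  have hval : IsClosedEmbedding (fun (f : ∀ w : PlacesOver E v, ↥(upperUnitriangular (Fin N) (w.1.adicCompletion E)))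
      (w : PlacesOver E v) =>
        ((f w : ↥(upperUnitriangular (Fin N) (w.1.adicCompletion E))) : GL (Fin N) (w.1.adicCompletion E))) :=
    IsClosedEmbedding.piMap fun w =>
      (isClosed_upperUnitriangular (n := N) (R := w.1.adicCompletion E)).isClosedEmbedding_subtypeVal
  have hN : IsClosed (unipotentU (conjLocal E c v) J' : Set ↥(unitaryGroupOfForm (conjLocal E c v) J')) :=
    (isClosed_upperUnitriangular (n := N) (R := LocalRing E v)).preimage continuous_subtype_val
  have hU : IsClosed (unitaryGroupOfForm (conjLocal E c v) J' : Set (GL (Fin N) (LocalRing E v))) :=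
    isClosed_unitaryGroupOfForm (continuous_conjLocal E c v) J'
  have hcomp : IsClosedEmbedding (fun x : ↥(unipotentU (conjLocal E c v) J') =>
      localGLPiEquiv E N v ((x : ↥(unitaryGroupOfForm (conjLocal E c v) J')) : GL (Fin N) (LocalRing E v))) :=
    (localGLPiEquiv E N v).toHomeomorph.isClosedEmbedding.comp
      (hU.isClosedEmbedding_subtypeVal.comp hN.isClosedEmbedding_subtypeVal)
  have hψ : IsClosedEmbedding ψ := IsClosedEmbedding.of_comp hval.isEmbedding hcomp
  exact IsLimitOfCompactOpen.of_isClosedEmbedding ψ hψ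
    (IsLimitOfCompactOpen.pi fun w => isLimitOfCompactOpen_upperUnitriangular (w.1.adicCompletion E) N)

end Local

/-! ## §3 The CM instances: the Borel of `U(Φ_N)(L⁺_v)` -/

section CM

variable (L : Type) [Field L] [NumberField L] [IsCMField L] (N : ℕ) (v : HeightOneSpectrum (𝓞 ↥(maximalRealSubfield L)))

/-- **`(cmBorelTriple L N v).N` is a limit of compact open subgroups** (the exactness hypothesis of ★ `jacquetMap_injective` for
the Borel triple of `U(Φ_N)(L⁺_v)`, every `N`, every finite place `v` of `L⁺`). [cite: BernsteinZelevinsky1977, §1.9] -/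
theorem isLimitOfCompactOpen_cmBorelTriple_N : IsLimitOfCompactOpen ↥(cmBorelTriple L N v).N :=
  isLimitOfCompactOpen_unipotentU_local L (IsCMField.complexConj L) N v (cmLocalForm L N v)

/-- **Left exactness of the Jacquet functor along the Borel of `U(Φ_N)(L⁺_v)`**: an injective intertwining map `f : ρ₁ → ρ₂` of
complex representations of `U(Φ_N)(L⁺_v)` with `ρ₂` smooth induces an INJECTION of Jacquet modules
`r_B ρ₁ → r_B ρ₂` (★ `Representation.jacquetMap_injective` with `IsLimitOfCompactOpen` discharged).
[cite: BernsteinZelevinsky1977, Prop. 1.9 (a)] [cite: Casselman1995, Prop. 3.2.3] -/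
theorem jacquetMap_cmBorel_injective {V₁ V₂ : Type*} [AddCommGroup V₁] [Module ℂ V₁] [AddCommGroup V₂] [Module ℂ V₂]
    {ρ₁ : Representation ℂ ↥(unitaryGroupOfForm (conjLocal L (IsCMField.complexConj L) v) (cmLocalForm L N v)) V₁}
    {ρ₂ : Representation ℂ ↥(unitaryGroupOfForm (conjLocal L (IsCMField.complexConj L) v) (cmLocalForm L N v)) V₂}
    (h₂ : ρ₂.IsSmooth) (f : ρ₁.IntertwiningMap ρ₂) (hf : Function.Injective f) :
    Function.Injective (Representation.jacquetMap (cmBorelTriple L N v) f) :=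
  Representation.jacquetMap_injective (cmBorelTriple L N v) (isLimitOfCompactOpen_cmBorelTriple_N L N v) h₂ f hf

end CM

end UnitaryGroup

end Literature.NumberTheory.Automorphic

end
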